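import Mathlib
import HarnessLib

/-!
# Format C, L-C3b mean-square tail: Abel summation bounds for `Σ g(m)·cos(mφ)`, `Σ g(m)·sin(mφ)`

Route context: Fourier–Galerkin / Schur-complement certificates of Weil positivity on a window ("format C";
cell memo `run/shared/lean/pub/rh-explicit/rh-explicit-weil-10/FORMATC-DESIGN.md` §9.9.3 (ii); supporting
stmt-RiemannHypothesis-0098; seat rh-explicit-weil-10).  The mean-square far bound of the order-`J` tail replaces the
square of the prime-sum bound `C_A²` by the mean square `½Σ_kΛ_k²/k` plus OSCILLATORY corrections
`Σ_{m≥B₃} cos(mφ)/m^E`, `φ ∈ {θ_k ± θ_{k'}}`, `θ_k = π log k / a`; these are small by Abel summation as long as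
`sin(φ/2) ≠ 0`, with the small divisors `1/|sin(φ/2)|` ("resonances": a product of two prime powers near `e^{2a}`)
carried explicitly.  This file supplies the two generic inequalities:

* `norm_sum_Ico_cexp_le` — `‖Σ_{m∈Ico M N} e^{imφ}‖ ≤ 1/|sin(φ/2)|`;
* `abs_sum_Ico_mul_cos_le`, `abs_sum_Ico_mul_sin_le` — for `g ≥ 0` antitone on `m ≥ M`:
  `|Σ_{m∈Ico M N} g(m)cos(mφ)| ≤ g(M)/|sin(φ/2)|` and the same with `sin` (Abel summation).

Elementary; standard axioms; no definitions; no RH claim.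
-/

set_option autoImplicit false
-- `Summit.RiemannHypothesis.RiemannHypothesis.…` is the layout-mandated namespace (summit = problem name).
set_option linter.dupNamespace false

noncomputable section

open Finset Complex
open scoped BigOperators Real

namespace Summit.RiemannHypothesis.RiemannHypothesis.Theorems.WeilFormatC

/-! ## The geometric sum of unimodular exponentials -/

section Geometric

/-- `e^{iφ} ≠ 1` when `sin(φ/2) ≠ 0`. -/
theorem cexp_mul_I_ne_one {φ : ℝ} (hφ : Real.sin (φ / 2) ≠ 0) : Complex.exp (I * φ) ≠ 1 := by
  intro h
  have h2 : ‖Complex.exp (I * φ) - 1‖ = ‖2 * Real.sin (φ / 2)‖ := Complex.norm_exp_I_mul_ofReal_sub_one φ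
  rw [h, sub_self, norm_zero] at h2
  have : (2 : ℝ) * Real.sin (φ / 2) = 0 := by
    have := h2.symm
    rwa [norm_eq_zero] at this
  exact hφ (by linarith [this])

/-- **Unimodular geometric sum**: `‖Σ_{m∈Ico M N} e^{imφ}‖ ≤ 1/|sin(φ/2)|` when `sin(φ/2) ≠ 0`. -/
theorem norm_sum_Ico_cexp_le {φ : ℝ} (hφ : Real.sin (φ / 2) ≠ 0) (M N : ℕ) :
    ‖∑ m ∈ Finset.Ico M N, Complex.exp (I * φ) ^ m‖ ≤ 1 / |Real.sin (φ / 2)| := by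
  have hz1 : Complex.exp (I * φ) ≠ 1 := cexp_mul_I_ne_one hφ
  have hnorm : ‖Complex.exp (I * φ)‖ = 1 := by
    rw [mul_comm]; exact Complex.norm_exp_ofReal_mul_I φ
  have hden : ‖Complex.exp (I * φ) - 1‖ = 2 * |Real.sin (φ / 2)| := by
    rw [Complex.norm_exp_I_mul_ofReal_sub_one, Real.norm_eq_abs, abs_mul, abs_of_pos (by norm_num : (0:ℝ) < 2)]
  have hspos : 0 < |Real.sin (φ / 2)| := abs_pos.mpr hφ
  by_cases hMN : M ≤ N
  · rw [geom_sum_Ico hz1 hMN, norm_div, hden]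
    have hnum : ‖Complex.exp (I * φ) ^ N - Complex.exp (I * φ) ^ M‖ ≤ 2 := by
      calc ‖Complex.exp (I * φ) ^ N - Complex.exp (I * φ) ^ M‖
          ≤ ‖Complex.exp (I * φ) ^ N‖ + ‖Complex.exp (I * φ) ^ M‖ := norm_sub_le _ _
        _ = 2 := by rw [norm_pow, norm_pow, hnorm, one_pow, one_pow]; norm_num
    rw [div_le_div_iff₀ (by positivity) hspos]
    nlinarith [hnum, hspos]
  · rw [Finset.Ico_eq_empty (by omega), Finset.sum_empty, norm_zero]
    positivity

end Geometric

/-! ## Abel summation against an antitone nonnegative weight -/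

section Abel

/-- **Abel bound, complex form.**  If `‖Σ_{m∈Ico M n} z_m‖ ≤ D` for every `n`, and `g` is nonnegative and antitone on
`m ≥ M`, then `‖Σ_{m∈Ico M N} g(m)·z_m‖ ≤ g(M)·D`. -/
theorem norm_sum_Ico_smul_le_of_partial {z : ℕ → ℂ} {g : ℕ → ℝ} {D : ℝ} {M : ℕ}
    (hD : ∀ n, ‖∑ m ∈ Finset.Ico M n, z m‖ ≤ D) (hg0 : ∀ m, M ≤ m → 0 ≤ g m)
    (hmono : ∀ m, M ≤ m → g (m + 1) ≤ g m) (N : ℕ) :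
    ‖∑ m ∈ Finset.Ico M N, (g m : ℂ) * z m‖ ≤ g M * D := by
  have hD0 : 0 ≤ D := le_trans (norm_nonneg _) (hD M)
  -- induction on N via the "Abel inequality": we prove the stronger statement for all N ≥ M
  -- S_N := Σ_{Ico M N} g z ;  S_{N+1} = S_N + g N z N.  Direct induction does not work; use summation by parts:
  -- Σ_{m<N'} g(M+m) z(M+m) with partial sums P_n = Σ_{m<n} z(M+m).
  by_cases hMN : M ≤ N
  swap
  · rw [Finset.Ico_eq_empty (by omega), Finset.sum_empty, norm_zero]
    exact mul_nonneg (hg0 M le_rfl) hD0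
  obtain ⟨L, rfl⟩ : ∃ L, N = M + L := ⟨N - M, by omega⟩
  -- shift to range
  have hshift : ∑ m ∈ Finset.Ico M (M + L), (g m : ℂ) * z m = ∑ i ∈ Finset.range L, (g (M + i) : ℂ) * z (M + i) := by
    rw [Finset.sum_Ico_eq_sum_range, Nat.add_sub_cancel_left]
  rw [hshift]
  -- partial sums of the shifted sequence
  set w : ℕ → ℂ := fun i ↦ z (M + i) with hw
  set f : ℕ → ℝ := fun i ↦ g (M + i) with hf
  have hP : ∀ n, ‖∑ i ∈ Finset.range n, w i‖ ≤ D := by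
    intro n
    have := hD (M + n)
    have e : ∑ m ∈ Finset.Ico M (M + n), z m = ∑ i ∈ Finset.range n, w i := by
      rw [Finset.sum_Ico_eq_sum_range, Nat.add_sub_cancel_left]
    rwa [e] at this
  have hf0 : ∀ i, 0 ≤ f i := fun i ↦ hg0 (M + i) (by omega)
  have hfmono : ∀ i, f (i + 1) ≤ f i := fun i ↦ by
    simp only [hf, ← add_assoc]; exact hmono (M + i) (by omega)
  -- summation by parts (Finset.sum_range_by_parts with the ℝ-action on ℂ)
  have hparts := Finset.sum_range_by_parts f w L
  have e2 : ∑ i ∈ Finset.range L, (g (M + i) : ℂ) * z (M + i) = ∑ i ∈ Finset.range L, f i • w i := by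
    refine Finset.sum_congr rfl fun i _ ↦ ?_
    simp only [hf, hw, Complex.real_smul]
  rw [e2, hparts]
  -- bound the two pieces
  have h1 : ‖f (L - 1) • ∑ i ∈ Finset.range L, w i‖ ≤ f (L - 1) * D := by
    rw [norm_smul, Real.norm_eq_abs, abs_of_nonneg (hf0 _)]
    exact mul_le_mul_of_nonneg_left (hP L) (hf0 _)
  have h2 : ‖∑ i ∈ Finset.range (L - 1), (f (i + 1) - f i) • ∑ j ∈ Finset.range (i + 1), w j‖
      ≤ ∑ i ∈ Finset.range (L - 1), (f i - f (i + 1)) * D := by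
    refine (norm_sum_le _ _).trans (Finset.sum_le_sum fun i _ ↦ ?_)
    rw [norm_smul, Real.norm_eq_abs, abs_sub_comm, abs_of_nonneg (by linarith [hfmono i])]
    exact mul_le_mul_of_nonneg_left (hP _) (by linarith [hfmono i])
  have htel : ∑ i ∈ Finset.range (L - 1), (f i - f (i + 1)) * D = (f 0 - f (L - 1)) * D := by
    rw [← Finset.sum_mul, Finset.sum_range_sub']
  calc ‖f (L - 1) • ∑ i ∈ Finset.range L, w i
        - ∑ i ∈ Finset.range (L - 1), (f (i + 1) - f i) • ∑ j ∈ Finset.range (i + 1), w j‖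
      ≤ ‖f (L - 1) • ∑ i ∈ Finset.range L, w i‖
        + ‖∑ i ∈ Finset.range (L - 1), (f (i + 1) - f i) • ∑ j ∈ Finset.range (i + 1), w j‖ := norm_sub_le _ _
    _ ≤ f (L - 1) * D + (f 0 - f (L - 1)) * D := add_le_add h1 (h2.trans (le_of_eq htel))
    _ = g M * D := by simp only [hf, add_zero]; ring

/-- **Abel bound for cosine sums**: for `sin(φ/2) ≠ 0`, `g ≥ 0` antitone on `m ≥ M`:
`|Σ_{m∈Ico M N} g(m)·cos(mφ)| ≤ g(M)/|sin(φ/2)|`. -/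
theorem abs_sum_Ico_mul_cos_le {φ : ℝ} (hφ : Real.sin (φ / 2) ≠ 0) {g : ℕ → ℝ} {M : ℕ}
    (hg0 : ∀ m, M ≤ m → 0 ≤ g m) (hmono : ∀ m, M ≤ m → g (m + 1) ≤ g m) (N : ℕ) :
    |∑ m ∈ Finset.Ico M N, g m * Real.cos (m * φ)| ≤ g M / |Real.sin (φ / 2)| := by
  have h := norm_sum_Ico_smul_le_of_partial (z := fun m ↦ Complex.exp (I * φ) ^ m) (g := g) (M := M)
    (fun n ↦ norm_sum_Ico_cexp_le hφ M n) hg0 hmono N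
  -- real part
  have hre : (∑ m ∈ Finset.Ico M N, (g m : ℂ) * Complex.exp (I * φ) ^ m).re
      = ∑ m ∈ Finset.Ico M N, g m * Real.cos (m * φ) := by
    rw [Complex.re_sum]
    refine Finset.sum_congr rfl fun m _ ↦ ?_
    rw [← Complex.exp_nat_mul, Complex.re_ofReal_mul]
    congr 1
    rw [show (m : ℂ) * (I * φ) = ((m * φ : ℝ) : ℂ) * I by push_cast; ring, Complex.exp_ofReal_mul_I_re]
  rw [← hre, div_eq_mul_one_div]
  exact (Complex.abs_re_le_norm _).trans h

/-- **Abel bound for sine sums**: for `sin(φ/2) ≠ 0`, `g ≥ 0` antitone on `m ≥ M`: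
`|Σ_{m∈Ico M N} g(m)·sin(mφ)| ≤ g(M)/|sin(φ/2)|`. -/
theorem abs_sum_Ico_mul_sin_le {φ : ℝ} (hφ : Real.sin (φ / 2) ≠ 0) {g : ℕ → ℝ} {M : ℕ}
    (hg0 : ∀ m, M ≤ m → 0 ≤ g m) (hmono : ∀ m, M ≤ m → g (m + 1) ≤ g m) (N : ℕ) :
    |∑ m ∈ Finset.Ico M N, g m * Real.sin (m * φ)| ≤ g M / |Real.sin (φ / 2)| := by
  have h := norm_sum_Ico_smul_le_of_partial (z := fun m ↦ Complex.exp (I * φ) ^ m) (g := g) (M := M)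
    (fun n ↦ norm_sum_Ico_cexp_le hφ M n) hg0 hmono N
  have him : (∑ m ∈ Finset.Ico M N, (g m : ℂ) * Complex.exp (I * φ) ^ m).im
      = ∑ m ∈ Finset.Ico M N, g m * Real.sin (m * φ) := by
    rw [Complex.im_sum]
    refine Finset.sum_congr rfl fun m _ ↦ ?_
    rw [← Complex.exp_nat_mul, Complex.im_ofReal_mul]
    congr 1
    rw [show (m : ℂ) * (I * φ) = ((m * φ : ℝ) : ℂ) * I by push_cast; ring, Complex.exp_ofReal_mul_I_im]
  rw [← him, div_eq_mul_one_div]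
  exact (Complex.abs_im_le_norm _).trans h

/-- The weight `g(m) = 1/m^E` is nonnegative and antitone on `m ≥ 1`; packaged Abel bounds for the inverse powers:
`|Σ_{m∈Ico B₃ N} cos(mφ)/m^E| ≤ (1/B₃^E)/|sin(φ/2)|` for `1 ≤ B₃`, and the same for `sin`. -/
theorem abs_sum_Ico_cos_div_pow_le {φ : ℝ} (hφ : Real.sin (φ / 2) ≠ 0) {B₃ : ℕ} (hB₃ : 1 ≤ B₃) (E N : ℕ) :
    |∑ m ∈ Finset.Ico B₃ N, 1 / (m : ℝ) ^ E * Real.cos (m * φ)| ≤ 1 / (B₃ : ℝ) ^ E / |Real.sin (φ / 2)| ∧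
    |∑ m ∈ Finset.Ico B₃ N, 1 / (m : ℝ) ^ E * Real.sin (m * φ)| ≤ 1 / (B₃ : ℝ) ^ E / |Real.sin (φ / 2)| := by
  have hg0 : ∀ m, B₃ ≤ m → 0 ≤ 1 / (m : ℝ) ^ E := fun m _ ↦ by positivity
  have hmono : ∀ m, B₃ ≤ m → 1 / ((m + 1 : ℕ) : ℝ) ^ E ≤ 1 / (m : ℝ) ^ E := by
    intro m hm
    have hm0 : (0 : ℝ) < m := by exact_mod_cast (lt_of_lt_of_le Nat.one_pos (le_trans hB₃ hm))
    apply div_le_div_of_nonneg_left zero_le_one (by positivity)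
    exact pow_le_pow_left₀ hm0.le (by push_cast; linarith) E
  exact ⟨abs_sum_Ico_mul_cos_le hφ hg0 hmono N, abs_sum_Ico_mul_sin_le hφ hg0 hmono N⟩

end Abel

end Summit.RiemannHypothesis.RiemannHypothesis.Theorems.WeilFormatC

end
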